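import Literature.Claims.NS.ClayVariants
import Literature.Claims.NS.ClayTorusMeanZeroBridge
import Literature.Analysis.FunctionSpaces.TorusClassicalNSHorizonPatching
import Literature.Analysis.FunctionSpaces.TorusSobolevNorm
import Literature.Analysis.FunctionSpaces.TorusCalculus
import Literature.Analysis.FunctionSpaces.TorusFluidGlue
import Literature.Analysis.FunctionSpaces.FlatTorus
import Literature.Analysis.FunctionSpaces.Complexify
import Literature.Analysis.FunctionSpaces.TorusSobolevNormSmoothProofs
import Literature.Analysis.ODE.SuperlinearPowerLawLocalBound
import HarnessLib

/-!
# Claim skeleton: Jun-De Li (2013), «On the existence of smooth periodic solutions of 3D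
# homogeneous Navier-Stokes equations», arXiv 1310.8031 v1

Cell `ns-claims` (D-0090 NS-CLAIMS SWEEP), claim C24, typist `ns-claims-typist-9`.
UNREFEREED/DISPUTED CLAIM under adjudication — NOTHING in this file asserts a step: every `Step…`
declaration is a `Prop` (the paper's assertion or asserted implication, typed concretely so that
its negation, its vacuity or its truth can be a kernel theorem in
`Summits/NavierStokesRegularity/NavierStokesRegularity/Theorems/SoloRefuteLi2013b.lean`); the
`theorem`s are the kernel COMPOSITIONS of the paper's own implications.

Version of record: Jun-De Li (Victoria University, Melbourne), arXiv:1310.8031 **v1** [math.AP],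
30 Oct 2013, 10 pp., PDF-only (Word); **v2 (6 Aug 2014) = withdrawal**, arXiv comment verbatim «The
solution for the NS equations provided can only be constant or very small magnitude». Bib key
`LiJunDe2013NSPeriodic`. Print page = PDF page; equation numbers (1)–(51) as printed. Sources and
locators: `pub/ns-claims/sources/Li2013b/` (ns-claims-lit-4); page renders used for every formula
(`kit` job j260795).

## Claimed statement (as printed)

Abstract, p. 1: «We prove that, in the absence of external forces and with divergence-free smooth
periodic initial data, periodic smooth solutions of the 3D Navier-Stokes equations exist for all time.»
Setting, pp. 1–3: periodic box Q = [0,L]³, «The periodic domain Q can be rescaled such that L = 1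
without loss of generality» (p. 2); V^m = «smooth, periodic and ZERO AVERAGE functions» (p. 2); Stokes
operator A = −Δ with eigenvalues (4) λ_k = (2π)²|k|², k ∈ ℤ³ ∖ {0}; norms ‖u‖²_{2s} = |A^s u|² =
Σ_j λ_j^{2s}|û_j|² (p. 3), so ‖u‖_r² = Σ_{k≠0} (4π²|k|²)^r |û(k)|². **Proposal 5, p. 7**: «For f = 0 and
smooth initial data u₀ ∈ V_σ such that (38) sup_{k<∞} ‖u₀‖_k = K₃ < ∞ then for any given T < ∞, there
exists an r such that for t < T, ‖u(t)‖_r is bounded, i.e. sup_{t∈[0,T]} ‖u(t,x)‖_r < ∞.» **Lemma 6,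
pp. 8–9**: «For the data given in proposal 5, there exists a smooth solution of the Navier-Stokes
equations such that (45) sup_{t∈[0,T], l<∞} ‖u(t,x)‖_l < ∞, (46) sup_{t∈[0,T], 1≤l<∞} ‖p(t,x)‖_l < ∞.
In (46), the pressure p is the normalized pressure as that defined in [7]» ([7] = Tao 2013; [8] =
Temam 1995). Typed: `ClaimedTheorem` = Lemma 6 (the paper's theorem, data class (38));
`AbstractClaim` = the abstract's sentence in the same setting (all smooth zero-average divergence-free
periodic data); `Delta4` = the unstated bridge «every such datum satisfies (38)».

## Clay delta (reference `ClayVariants.lean`)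

Nearest: (B) = `ClayVariants.clayPeriodic.Regularity` (normalised = periodic mean-zero pressure, p. 9
(51) with [7]: the CMI-errata reading `clayPeriodicErrata`, harmless for REG by
`clayPeriodicErrata_regularity_imp_printed`). Axes: Δ1 periodic box, L = 1 WLOG (=) · Δ3 f = 0 (=) ·
**Δ4 data: (38) sup_k ‖u₀‖_k ≤ K₃ — a bound UNIFORM IN k on all the spectral norms of a zero-average
field on the unit box, where every mode has λ_k ≥ 4π² > 1 (so ‖u₀‖_k ≥ (2π)^k |u₀|_{L²}); the abstract
speaks of ALL smooth periodic divergence-free data (Clay (8)); the bridge is `Delta4`** · Δ5 smooth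
periodic solution on [0,T] × Q with normalised pressure (=) · Δ6 horizon «any given T» (every T;
[0,∞) by patching — classical) · Δ7 ν kept general (=) · zero average of u (p. 2) — harmless for f = 0
(mean conserved; Galilean reduction), carried as part of the setting. The Clay link is typed through
`AbstractClaim` and the transport hypothesis `ClayBridge` (`clay_of_abstract` PROVED); `ClaimedTheorem`
reaches `AbstractClaim` exactly through `Delta4` (`abstract_of_claimed_of_delta4` PROVED).

## Steps (paper item · print page · typist's private flag)

* Step 1 = `Step1_Lemma4` — Lemma 4 [8], (27) pp. 6–7 with the constant (37), used with f = 0 as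
  (39) p. 8: the H^r energy inequality for smooth solutions, ONE constant c′ for all r as the text
  uses it at (43)/(48) — plausible up to the r-uniformity of c′ (support/consumed by the composition).
* Step 2 = `Step2_Poincare40` — (40) p. 8 «the last inequality is derived after using (9)»:
  λ₁^{r−1}‖u‖₁² ≤ ‖u‖_r² for zero-average fields (λ₁ = 4π²) — classical; CONSUMED.
* Step 3 = `Step3_Comparison42` — (41) ⇒ (42) ⇒ (43) p. 8 «Applying the Gronwall type of inequality»:
  scalar comparison for y′ ≤ C y^{(4r−1)/(2r−1)}, bounded on [0,T] when T < T* = (2r−1)/(2rC y₀^{2r/(2r−1)})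
  — classical; CONSUMED.
* Step 4 = `Step4_HorizonGrows` — p. 8, sentence after (43): «For smooth initial data as given in (38),
  the T in (43) can increase without bound as r increases because, from (4), λ₁ = 4π² with |k|_min = 1»
  — real arithmetic on the printed T(r) with c(r) of (37): TRUE-looking ((4π²)^{r−1} beats 2^{r+1});
  CONSUMED.
* Step 5 = `Step5_Proposal5` — Proposal 5 p. 7 as printed (a priori bound under (38)) — typist's flag:
  TRUE BUT VACUOUS: for a zero-average field on the unit box, (38) forces u₀ = 0 (each mode has
  λ_k ≥ 4π² > 1, so ‖u₀‖_k² ≥ (4π²)^k |u₀|²_{L²} is bounded in k only if u₀ = 0) — the author's own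
  withdrawal comment; THE LOCATOR CANDIDATE (hypothesis (38), p. 7) — vacuity target
  `∀ u₀ K₃, DataClass38 u₀ K₃ → u₀ = 0`; CONSUMED (by Step 6).
* Step 6 = `Step6_Lemma6` — Lemma 6 pp. 8–9 ((47)–(51): Prop 5 + local strong theory [8] + Tao's
  normalised pressure): the asserted implication Proposition 5 ⇒ Lemma 6 — plausible given classical
  theory (and trivially true on the class (38) = {0}); CONSUMED.
* `Delta4` — the unstated passage abstract ↔ Proposal 5 («smooth initial data as given in (38)»,
  pp. 7–9, vs «divergence-free smooth periodic initial data», p. 1): every smooth zero-average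
  divergence-free periodic datum satisfies (38) — typist's flag: FALSE-looking (any datum with one
  non-zero mode); the «wrong problem (Δ4)» axis.

## COMPOSITION — proved

`prop5_of_steps : Step1 → Step2 → Step3 → Step4 → Step5_Proposal5` (the printed proof of Proposal 5,
pp. 7–8, as kernel plumbing: pick r by Step 4, differentiate ‖u‖_r² by Step 1, close (41) with Step 2,
bound by Step 3) and `claim_of_steps : Step1 → Step2 → Step3 → Step4 → Step6 → ClaimedTheorem`;
`abstract_of_claimed_of_delta4 : Delta4 → ClaimedTheorem → AbstractClaim`; `clay_of_abstract :
ClayBridge → AbstractClaim → clayPeriodic.Regularity` — all PROVED (logic + one line of real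
arithmetic). The paper's logic composes; the adjudication is about (38) (vacuity, p. 7) and `Delta4`.

## Design / conventions

Unit flat torus `UnitAddTorus (Fin 3)` (L = 1, p. 2); ‖v‖_r² := (2π)^{2r} · |v|²_{Ḣ^r} with the tree's
spectral `FunctionSpaces.Torus.eHomSobolevSeminorm` of the complexified field (= Σ_{k≠0}(4π²|k|²)^r|v̂(k)|²,
the paper's |A^{r/2}v|², (4)–(7) p. 3); smooth solution = the tree's
`FunctionSpaces.Torus.IsClassicalNSSolutionOn (Icc 0 T) ν 0 u p` with u(0) = u₀, smooth zero-average
divergence-free slices and mean-zero (normalised) pressure (Definition 3 [7] p. 6; (51) p. 9). The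
exponent (4r−1)/(2r−1) of (41) is written as y·y^{2r/(2r−1)} (equal for y ≥ 0) so that the compositions
are exponent-bookkeeping free.

WHAT THIS IS NOT: not a claim about NS regularity or blow-up; not a claim about any author beyond the
typed locator.
-/

open MeasureTheory Set Filter
open scoped ENNReal NNReal Topology

namespace Literature.Claims.NS.Li2013b

open Literature.Analysis
open Literature.Analysis.FunctionSpaces.EuclideanSpace (complexify)

noncomputable section

/-! ## §A. Vocabulary (definitions with bodies; nothing asserted) -/

/-- λ₁ = 4π²: the first Stokes eigenvalue on the unit periodic box for zero-average fields ((4) p. 3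
with |k|_min = 1, p. 8). [cite: LiJunDe2013NSPeriodic, eq. (4) p. 3; p. 8] -/
def lam1 : ℝ := 4 * Real.pi ^ 2

/-- The paper's squared norm ‖v‖_r² = |A^{r/2}v|² = Σ_{k≠0} λ_k^r |v̂(k)|², λ_k = 4π²|k|² ((4)–(7) and
the display after (7), p. 3), as an extended number: (2π)^{2r} times the square of the tree's spectral
homogeneous seminorm `|v|_{Ḣ^r}` of the complexified field. [cite: LiJunDe2013NSPeriodic, eq. (4)–(7) p. 3] -/
def normSq (r : ℕ) (v : UnitAddTorus (Fin 3) → EuclideanSpace ℝ (Fin 3)) : ℝ≥0∞ :=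
  ENNReal.ofReal ((2 * Real.pi) ^ (2 * r)) *
    FunctionSpaces.Torus.eHomSobolevSeminorm (r : ℝ) (complexify ∘ v) ^ 2

/-- The same squared norm for a scalar (pressure) slice, ‖p‖_l² ((46) p. 9), via the complexified
scalar. [cite: LiJunDe2013NSPeriodic, eq. (46) p. 9] -/
def normSqScalar (l : ℕ) (q : UnitAddTorus (Fin 3) → ℝ) : ℝ≥0∞ :=
  ENNReal.ofReal ((2 * Real.pi) ^ (2 * l)) *
    FunctionSpaces.Torus.eHomSobolevSeminorm (l : ℝ) (fun x => ((q x : ℝ) : ℂ)) ^ 2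

/-- «smooth initial data u₀ ∈ V_σ» (Proposal 5, p. 7) in the paper's spaces (p. 2: smooth, periodic,
ZERO AVERAGE, divergence free). [cite: LiJunDe2013NSPeriodic, §2 p. 2; Proposal 5 p. 7] -/
def IsDatum (v : UnitAddTorus (Fin 3) → EuclideanSpace ℝ (Fin 3)) : Prop :=
  FunctionSpaces.Torus.IsSmooth v ∧ FunctionSpaces.Torus.IsDivFree v ∧ FunctionSpaces.Torus.HasZeroMean v

/-- **The data class (38), p. 7**: «smooth initial data u₀ ∈ V_σ such that sup_{k<∞} ‖u₀‖_k = K₃ < ∞»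
— all the norms ‖u₀‖_k, k = 0, 1, 2, …, bounded by one K₃. [cite: LiJunDe2013NSPeriodic, eq. (38) p. 7] -/
def DataClass38 (u₀ : UnitAddTorus (Fin 3) → EuclideanSpace ℝ (Fin 3)) (K₃ : ℝ≥0) : Prop :=
  IsDatum u₀ ∧ ∀ k : ℕ, normSq k u₀ ≤ (K₃ : ℝ≥0∞) ^ 2

/-- **Periodic smooth solution with f = 0 from u₀ on [0,T]** (Definition 3 [7], p. 6: «the velocity field
u : [0,T] × Q → ℝ³ and pressure field p : [0,T] × Q → ℝ are smooth functions on [0,T] × Q that obey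
equation (15) on all [0,T] × Q and satisfy the initial condition (26)»), in the paper's zero-average
setting (p. 2) with the normalised (mean-zero, periodic) pressure of (51) p. 9: the tree's classical
torus solution on `Icc 0 T` with force 0, plus u(0) = u₀, smooth divergence-free zero-average velocity
slices and zero-average pressure slices. [cite: LiJunDe2013NSPeriodic, Definition 3 p. 6; eq. (51) p. 9] -/
def IsSmoothSolution (T ν : ℝ) (u₀ : UnitAddTorus (Fin 3) → EuclideanSpace ℝ (Fin 3))
    (u : ℝ → UnitAddTorus (Fin 3) → EuclideanSpace ℝ (Fin 3)) (p : ℝ → UnitAddTorus (Fin 3) → ℝ) :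
    Prop :=
  FunctionSpaces.Torus.IsClassicalNSSolutionOn (Icc 0 T) ν 0 u p ∧ u 0 = u₀ ∧
    (∀ t ∈ Icc 0 T, IsDatum (u t)) ∧ ∀ t ∈ Icc 0 T, FunctionSpaces.Torus.HasZeroMean (p t)

/-- The constant (37), p. 7: c = (2^{r+1} c′/ν)^{(2r+1)/(2r−1)} (c′ «depends on k and Q», p. 7; one c′
for all r as used at (43) and (48)). [cite: LiJunDe2013NSPeriodic, eq. (37) p. 7] -/
def cConst (r : ℕ) (c' ν : ℝ) : ℝ :=
  (2 ^ (r + 1) * c' / ν) ^ (((2 : ℝ) * r + 1) / (2 * r - 1))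

/-- The exponent 2r/(2r−1) (so that ‖u‖_r^{4r/(2r−1)} = (‖u‖_r²)^{2r/(2r−1)}, (39)–(42) pp. 7–8).
[cite: LiJunDe2013NSPeriodic, eq. (39)–(42) p. 8] -/
def expo (r : ℕ) : ℝ :=
  (2 : ℝ) * r / (2 * r - 1)

/-! ## §B. Claimed statement, the abstract's sentence, the Δ4 bridge, the Clay link -/

/-- **Lemma 6, pp. 8–9, as printed (the paper's theorem)**: for f = 0, every ν > 0 and every datum of
the class (38), for any given T there is a periodic smooth solution on [0,T] from u₀ with
(45) sup_{t∈[0,T], l} ‖u(t)‖_l < ∞ and (46) sup_{t∈[0,T], 1≤l} ‖p(t)‖_l < ∞ (normalised pressure).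
[cite: LiJunDe2013NSPeriodic, Lemma 6 pp. 8–9] -/
def ClaimedTheorem : Prop :=
  ∀ ν : ℝ, 0 < ν →
    ∀ (u₀ : UnitAddTorus (Fin 3) → EuclideanSpace ℝ (Fin 3)) (K₃ : ℝ≥0), DataClass38 u₀ K₃ →
      ∀ T : ℝ, 0 < T →
        ∃ (u : ℝ → UnitAddTorus (Fin 3) → EuclideanSpace ℝ (Fin 3)) (p : ℝ → UnitAddTorus (Fin 3) → ℝ),
          IsSmoothSolution T ν u₀ u p ∧
            (∃ M : ℝ≥0, ∀ t ∈ Icc 0 T, ∀ l : ℕ, normSq l (u t) ≤ (M : ℝ≥0∞)) ∧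
            ∃ M : ℝ≥0, ∀ t ∈ Icc 0 T, ∀ l : ℕ, 1 ≤ l → normSqScalar l (p t) ≤ (M : ℝ≥0∞)

/-- **The abstract's sentence, p. 1, in the paper's setting**: «in the absence of external forces and
with divergence-free smooth periodic initial data, periodic smooth solutions of the 3D Navier-Stokes
equations exist for all time» — for every ν > 0, every smooth zero-average divergence-free datum on the
unit box and every T, a periodic smooth solution on [0,T]. [cite: LiJunDe2013NSPeriodic, Abstract p. 1] -/
def AbstractClaim : Prop :=
  ∀ ν : ℝ, 0 < ν →
    ∀ u₀ : UnitAddTorus (Fin 3) → EuclideanSpace ℝ (Fin 3), IsDatum u₀ →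
      ∀ T : ℝ, 0 < T →
        ∃ (u : ℝ → UnitAddTorus (Fin 3) → EuclideanSpace ℝ (Fin 3)) (p : ℝ → UnitAddTorus (Fin 3) → ℝ),
          IsSmoothSolution T ν u₀ u p

/-- **Δ4 — the unstated bridge between the abstract (p. 1) and Proposal 5 / Lemma 6 (pp. 7–9)**: every
smooth zero-average divergence-free periodic datum satisfies (38) for some K₃. Typist's flag:
FALSE-looking (on the unit box every mode has λ_k ≥ 4π² > 1, so ‖u₀‖_k → ∞ unless u₀ = 0; the
author's withdrawal comment «can only be constant or very small magnitude»). Not printed as a claim;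
typed because it is exactly what `abstract_of_claimed_of_delta4` needs (TYPING-HYGIENE 10 (b)).
[cite: LiJunDe2013NSPeriodic, Abstract p. 1; eq. (38) p. 7] -/
def Delta4 : Prop :=
  ∀ u₀ : UnitAddTorus (Fin 3) → EuclideanSpace ℝ (Fin 3), IsDatum u₀ → ∃ K₃ : ℝ≥0, DataClass38 u₀ K₃

/-- Under Δ4 the paper's theorem gives the abstract's sentence. Pure logic.
[cite: LiJunDe2013NSPeriodic, Abstract p. 1; Lemma 6 pp. 8–9] -/
theorem abstract_of_claimed_of_delta4 (hΔ : Delta4) (hC : ClaimedTheorem) : AbstractClaim := by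
  intro ν hν u₀ hu₀ T hT
  obtain ⟨K₃, hK⟩ := hΔ u₀ hu₀
  obtain ⟨u, p, hsol, -, -⟩ := hC ν hν u₀ K₃ hK T hT
  exact ⟨u, p, hsol⟩

/-- **Clay bridge** (axes Δ6 patching [0,T] → [0,∞), zero-average reduction, and the transport torus ↔
lattice-periodic fields on ℝ³ of `ClayVariants.lean` §3; a classical bridge, not a claim of the paper):
for every ν > 0 and every Clay (B) datum u₀ there is a torus datum v₀ of the paper's class such that
solvability on every [0,T] from v₀ (in the sense `IsSmoothSolution`) yields a Clay-sense periodic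
solution from u₀. [cite: FeffermanClay2006, (B) with (8) (10) (11), p. 2] -/
def ClayBridge : Prop :=
  ∀ ν : ℝ, 0 < ν →
    ∀ u₀ : EuclideanSpace ℝ (Fin 3) → EuclideanSpace ℝ (Fin 3),
      ContDiff ℝ ((⊤ : ℕ∞) : WithTop ℕ∞) u₀ → FluidPDE.NSWave0.IsDivFree u₀ → FluidPDE.IsLatticePeriodic u₀ →
        ∃ v₀ : UnitAddTorus (Fin 3) → EuclideanSpace ℝ (Fin 3), IsDatum v₀ ∧
          ((∀ T : ℝ, 0 < T →
              ∃ (u : ℝ → UnitAddTorus (Fin 3) → EuclideanSpace ℝ (Fin 3))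
                (p : ℝ → UnitAddTorus (Fin 3) → ℝ), IsSmoothSolution T ν v₀ u p) →
            ClayVariants.clayPeriodic.Solvable ν 0 u₀)

/-- Under the Clay bridge, the abstract's sentence implies Clay (B). Pure logic.
[cite: FeffermanClay2006, (B) p. 2] -/
theorem clay_of_abstract (hB : ClayBridge) (hA : AbstractClaim) :
    ClayVariants.clayPeriodic.Regularity := by
  intro ν hν u₀ hsmooth hdiv hper
  obtain ⟨v₀, hv₀, hbridge⟩ := hB ν hν u₀ hsmooth hdiv hper
  exact hbridge fun T hT => hA ν hν v₀ hv₀ T hT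

/-! ## §C. The steps -/

/-- **Step 1 — Lemma 4 [8], (27) pp. 6–7 with the constant (37), in the form (39) p. 8 (f = 0):** for
every smooth solution and every r ≥ 1, y(t) = ‖u(t)‖_r² is continuous on [0,T] and, at each t ∈ [0,T),
right-differentiable with «d/dt ‖u‖_r² + ν‖u‖²_{r+1} ≤ c ‖u‖₁² ‖u‖_r^{4r/(2r−1)}», c = (2^{r+1}c′/ν)^{(2r+1)/(2r−1)},
with ONE constant c′ for all r (as the text uses c′ at (43) and (48); printed: «c′ depends on k and Q»).
Typist's flag: plausible as an H^r energy inequality (Temam [8]); the r-uniformity of c′ is the paper's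
bookkeeping (suspicious, not load-bearing for the verdict). [cite: LiJunDe2013NSPeriodic, Lemma 4 (27) p. 6; (36)–(37) p. 7; (39) p. 8] -/
def Step1_Lemma4 : Prop :=
  ∃ c' : ℝ, 0 < c' ∧
    ∀ ν : ℝ, 0 < ν → ∀ T : ℝ, 0 < T → ∀ r : ℕ, 1 ≤ r →
      ∀ (u₀ : UnitAddTorus (Fin 3) → EuclideanSpace ℝ (Fin 3))
        (u : ℝ → UnitAddTorus (Fin 3) → EuclideanSpace ℝ (Fin 3)) (p : ℝ → UnitAddTorus (Fin 3) → ℝ),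
        IsSmoothSolution T ν u₀ u p →
          ContinuousOn (fun t => (normSq r (u t)).toReal) (Icc 0 T) ∧
            ∀ t ∈ Ico 0 T, ∃ y' : ℝ,
              HasDerivWithinAt (fun s => (normSq r (u s)).toReal) y' (Ici t) t ∧
                y' + ν * (normSq (r + 1) (u t)).toReal ≤
                  cConst r c' ν * (normSq 1 (u t)).toReal * (normSq r (u t)).toReal ^ expo r

/-- **Step 2 — (40) p. 8, «the last inequality is derived after using (9)»** (the Poincaré chain
‖u‖²_m/‖u‖²_{m+1} ≤ 1/λ₁, (9) p. 3, telescoped): for every smooth zero-average divergence-free field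
and r ≥ 1, ‖v‖_r² is finite and λ₁^{r−1} ‖v‖₁² ≤ ‖v‖_r². Typist's flag: classical (λ_k ≥ λ₁ = 4π²
termwise). [cite: LiJunDe2013NSPeriodic, eq. (9) p. 3; (40) p. 8] -/
def Step2_Poincare40 : Prop :=
  ∀ v : UnitAddTorus (Fin 3) → EuclideanSpace ℝ (Fin 3), IsDatum v → ∀ r : ℕ, 1 ≤ r →
    normSq r v < ∞ ∧ lam1 ^ (r - 1) * (normSq 1 v).toReal ≤ (normSq r v).toReal

/-- **Step 3 — (41) ⇒ (42) ⇒ (43), p. 8, «Applying the Gronwall type of inequality»:** scalar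
comparison — a continuous non-negative y on [0,T] with right derivatives y′ ≤ C·y·y^{2r/(2r−1)}
(= C y^{(4r−1)/(2r−1)}) on [0,T) and y(0) ≤ y₀ stays bounded on [0,T] provided
T·2rC y₀^{2r/(2r−1)} < 2r − 1, i.e. T < T* of (43) (bound (42)). Typist's flag: classical ODE comparison.
[cite: LiJunDe2013NSPeriodic, eq. (41)–(43) p. 8] -/
def Step3_Comparison42 : Prop :=
  ∀ (y : ℝ → ℝ) (T C y₀ : ℝ) (r : ℕ), 1 ≤ r → 0 < C → 0 ≤ y₀ →
    ContinuousOn y (Icc 0 T) → (∀ t ∈ Icc 0 T, 0 ≤ y t) → y 0 ≤ y₀ →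
      (∀ t ∈ Ico 0 T, ∃ y' : ℝ, HasDerivWithinAt y y' (Ici t) t ∧ y' ≤ C * y t * y t ^ expo r) →
        T * (2 * r * C * y₀ ^ expo r) < 2 * r - 1 →
          ∃ M : ℝ, ∀ t ∈ Icc 0 T, y t ≤ M

/-- **Step 4 — p. 8, the sentence after (43):** «For smooth initial data as given in (38), the T in
(43) can increase without bound as r increases because, from (4), λ₁ = 4π² with |k|_min = 1. This shows
that for any given T < ∞, there exists an r such that …» — with C(r) = c(r)·λ₁^{−(r−1)} ((41)) and
y₀ = K₃² ((38)): for every T there is an r ≥ 1 with T·2rC(r)K₃^{4r/(2r−1)} < 2r − 1 (T < T*(r) of (43)).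
Typist's flag: TRUE-looking real arithmetic ((4π²)^{r−1} against 2^{r+1}). [cite: LiJunDe2013NSPeriodic, p. 8 after (43)] -/
def Step4_HorizonGrows : Prop :=
  ∀ c' ν : ℝ, 0 < c' → 0 < ν → ∀ (K₃ : ℝ≥0) (T : ℝ), ∃ r : ℕ, 1 ≤ r ∧
    T * (2 * r * (cConst r c' ν * (lam1 ^ (r - 1))⁻¹) * ((K₃ : ℝ) ^ 2) ^ expo r) < 2 * r - 1

/-- **Step 5 — Proposal 5, p. 7, as printed** (an a-priori bound): for f = 0, ν > 0 and data of the
class (38), for any given T there is an r (≥ 1) such that every periodic smooth solution on [0,T] from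
u₀ has sup_{t∈[0,T]} ‖u(t)‖_r < ∞. Typist's flag: TRUE BUT VACUOUS — for zero-average fields on the
unit box (38) forces u₀ = 0 (every mode has λ_k ≥ 4π² > 1); LOCATOR CANDIDATE = hypothesis (38),
p. 7 (vacuity shape `∀ u₀ K₃, DataClass38 u₀ K₃ → u₀ = 0`). [cite: LiJunDe2013NSPeriodic, Proposal 5 p. 7] -/
def Step5_Proposal5 : Prop :=
  ∀ ν : ℝ, 0 < ν →
    ∀ (u₀ : UnitAddTorus (Fin 3) → EuclideanSpace ℝ (Fin 3)) (K₃ : ℝ≥0), DataClass38 u₀ K₃ →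
      ∀ T : ℝ, 0 < T → ∃ r : ℕ, 1 ≤ r ∧
        ∀ (u : ℝ → UnitAddTorus (Fin 3) → EuclideanSpace ℝ (Fin 3)) (p : ℝ → UnitAddTorus (Fin 3) → ℝ),
          IsSmoothSolution T ν u₀ u p → ∃ M : ℝ, ∀ t ∈ Icc 0 T, (normSq r (u t)).toReal ≤ M

/-- **Step 6 — Lemma 6, pp. 8–9 ((47)–(51))**: «A solution satisfying the relation (45) also satisfies
(23), thus it is a strong solution … it is concluded that the velocity field satisfying (45) is a smooth
solution for the given initial condition (38)», pressure by (50)–(51): the asserted implication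
Proposition 5 ⇒ Lemma 6 (local strong theory [8] + continuation by the a-priori bound + bootstrap).
Typist's flag: plausible given classical theory (and trivially true on the class (38)). [cite: LiJunDe2013NSPeriodic, Lemma 6 pp. 8–9] -/
def Step6_Lemma6 : Prop :=
  Step5_Proposal5 → ClaimedTheorem

/-! ## §D. Compositions -/

/-- **Proposal 5 from Steps 1–4 — the printed proof, pp. 7–8, as kernel plumbing:** take c′ from
Lemma 4 (Step 1); choose r by Step 4; for a smooth solution put y(t) = ‖u(t)‖_r², C = c(r)λ₁^{−(r−1)};
Step 1 and Step 2 give (41) in the form y′ ≤ C·y·y^{2r/(2r−1)}; y(0) = ‖u₀‖_r² ≤ K₃² by (38); Step 3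
bounds y on [0,T]. [cite: LiJunDe2013NSPeriodic, proof of Proposal 5 pp. 7–8] -/
theorem prop5_of_steps (h1 : Step1_Lemma4) (h2 : Step2_Poincare40) (h3 : Step3_Comparison42)
    (h4 : Step4_HorizonGrows) : Step5_Proposal5 := by
  intro ν hν u₀ K₃ hD T hT
  obtain ⟨c', hc', H1⟩ := h1
  obtain ⟨r, hr, hTr⟩ := h4 c' ν hc' hν K₃ T
  refine ⟨r, hr, fun u p hsol => ?_⟩
  obtain ⟨hcont, hderiv⟩ := H1 ν hν T hT r hr u₀ u p hsol
  -- the constants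
  have hlam : 0 < lam1 := by unfold lam1; positivity
  have hL : 0 < lam1 ^ (r - 1) := pow_pos hlam _
  have hc : 0 < cConst r c' ν := by
    unfold cConst
    exact Real.rpow_pos_of_pos (by positivity) _
  set C : ℝ := cConst r c' ν * (lam1 ^ (r - 1))⁻¹ with hCdef
  have hC : 0 < C := mul_pos hc (inv_pos.2 hL)
  -- y(0) ≤ K₃²
  have hy0 : (normSq r (u 0)).toReal ≤ (K₃ : ℝ) ^ 2 := by
    have hb : normSq r u₀ ≤ (K₃ : ℝ≥0∞) ^ 2 := hD.2 r
    rw [hsol.2.1]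
    have hK : ((K₃ : ℝ≥0∞) ^ 2).toReal = (K₃ : ℝ) ^ 2 := by
      simp [ENNReal.toReal_pow]
    rw [← hK]
    exact ENNReal.toReal_mono (by simp) hb
  refine h3 (fun t => (normSq r (u t)).toReal) T C ((K₃ : ℝ) ^ 2) r hr hC (by positivity) hcont
    (fun t _ => ENNReal.toReal_nonneg) hy0 ?_ hTr
  intro t ht
  obtain ⟨y', hy', hbound⟩ := hderiv t ht
  refine ⟨y', hy', ?_⟩
  have htIcc : t ∈ Icc 0 T := Ico_subset_Icc_self ht
  obtain ⟨-, hP⟩ := h2 (u t) (hsol.2.2.1 t htIcc) r hr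
  -- ‖u‖₁² ≤ λ₁^{-(r-1)} ‖u‖_r²
  have hP' : (normSq 1 (u t)).toReal ≤ (lam1 ^ (r - 1))⁻¹ * (normSq r (u t)).toReal := by
    rw [le_inv_mul_iff₀ hL]
    exact hP
  have hD0 : 0 ≤ ν * (normSq (r + 1) (u t)).toReal := mul_nonneg hν.le ENNReal.toReal_nonneg
  have hpow : 0 ≤ (normSq r (u t)).toReal ^ expo r := Real.rpow_nonneg ENNReal.toReal_nonneg _
  calc y' ≤ cConst r c' ν * (normSq 1 (u t)).toReal * (normSq r (u t)).toReal ^ expo r := by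
        linarith
    _ ≤ cConst r c' ν * ((lam1 ^ (r - 1))⁻¹ * (normSq r (u t)).toReal) *
          (normSq r (u t)).toReal ^ expo r := by
        gcongr
    _ = C * (normSq r (u t)).toReal * (normSq r (u t)).toReal ^ expo r := by
        rw [hCdef]; ring

/-- **COMPOSITION (kernel): the paper's logic composes.** From Steps 1–4 (⇒ Proposal 5, `prop5_of_steps`)
and Step 6 (Lemma 6) to the claimed theorem. Nothing here asserts any step.
[cite: LiJunDe2013NSPeriodic, Proposal 5 p. 7; Lemma 6 pp. 8–9] -/
theorem claim_of_steps (h1 : Step1_Lemma4) (h2 : Step2_Poincare40) (h3 : Step3_Comparison42)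
    (h4 : Step4_HorizonGrows) (h6 : Step6_Lemma6) : ClaimedTheorem :=
  h6 (prop5_of_steps h1 h2 h3 h4)

/-- The full chain to Clay (B) through the two bridges (Δ4 and the transport), for the record.
[cite: FeffermanClay2006, (B) p. 2] -/
theorem clay_of_steps (h1 : Step1_Lemma4) (h2 : Step2_Poincare40) (h3 : Step3_Comparison42)
    (h4 : Step4_HorizonGrows) (h6 : Step6_Lemma6) (hΔ : Delta4) (hB : ClayBridge) :
    ClayVariants.clayPeriodic.Regularity :=
  clay_of_abstract hB (abstract_of_claimed_of_delta4 hΔ (claim_of_steps h1 h2 h3 h4 h6))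

/-! ## Discharged TRUE step: Step 4 (append-only; ns-claims D-0026 debt pass, typist-9 g4)

The sentence after (43), p. 8 — «the T in (43) can increase without bound as r increases because
λ₁ = 4π²» — is real arithmetic: `c(r) ≤ 8^{r+1}(c′/ν + 1)³` (the exponent `(2r+1)/(2r−1) ≤ 3`),
`(K₃²)^{2r/(2r−1)} ≤ (K₃² + 1)²`, so `T·2r·c(r)λ₁^{−(r−1)}K₃^{4r/(2r−1)} ≤ 128·T·(c′/ν+1)³(K₃²+1)²·
r·(8/λ₁)^{r−1}` with `8/λ₁ = 2/π² < 1`, which is `< r ≤ 2r − 1` for `r` large. -/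

/-- `λ₁ = 4π² > 8`. [cite: LiJunDe2013NSPeriodic, eq. (4) p. 3] -/
private theorem eight_lt_lam1 : 8 < lam1 := by
  have hπ := Real.pi_gt_three
  unfold lam1
  nlinarith

/-- `0 < λ₁`. [cite: LiJunDe2013NSPeriodic, eq. (4) p. 3] -/
private theorem lam1_pos' : 0 < lam1 := lt_trans (by norm_num) eight_lt_lam1

/-- The exponent `2r/(2r−1)` lies in `[0, 2]` for `r ≥ 1`. [cite: LiJunDe2013NSPeriodic, eq. (39)–(42) p. 8] -/
private theorem expo_nonneg_of_one_le {r : ℕ} (hr : 1 ≤ r) : 0 ≤ expo r := by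
  unfold expo
  have hr' : (1 : ℝ) ≤ r := by exact_mod_cast hr
  exact div_nonneg (by positivity) (by linarith)

/-- `2r/(2r−1) ≤ 2` for `r ≥ 1`. [cite: LiJunDe2013NSPeriodic, eq. (39)–(42) p. 8] -/
private theorem expo_le_two_of_one_le {r : ℕ} (hr : 1 ≤ r) : expo r ≤ 2 := by
  unfold expo
  have hr' : (1 : ℝ) ≤ r := by exact_mod_cast hr
  rw [div_le_iff₀ (by linarith)]
  linarith

/-- `c(r) = (2^{r+1}c′/ν)^{(2r+1)/(2r−1)} ≤ 8^{r+1}(c′/ν + 1)³` for `r ≥ 1` (the exponent is `≤ 3`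
and `2^{r+1}c′/ν + 1 ≤ 2^{r+1}(c′/ν + 1)`). [cite: LiJunDe2013NSPeriodic, eq. (37) p. 7] -/
private theorem cConst_le {r : ℕ} (hr : 1 ≤ r) {c' ν : ℝ} (hc : 0 < c') (hν : 0 < ν) :
    cConst r c' ν ≤ 8 ^ (r + 1) * (c' / ν + 1) ^ 3 := by
  unfold cConst
  have hr' : (1 : ℝ) ≤ r := by exact_mod_cast hr
  set b : ℝ := 2 ^ (r + 1) * c' / ν with hb
  have hb0 : 0 ≤ b := by positivity
  have he0 : 0 ≤ ((2 : ℝ) * r + 1) / (2 * r - 1) := div_nonneg (by positivity) (by linarith)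
  have he3 : ((2 : ℝ) * r + 1) / (2 * r - 1) ≤ 3 := by
    rw [div_le_iff₀ (by linarith)]
    linarith
  have h1 : b ^ (((2 : ℝ) * r + 1) / (2 * r - 1)) ≤ (b + 1) ^ (((2 : ℝ) * r + 1) / (2 * r - 1)) :=
    Real.rpow_le_rpow hb0 (by linarith) he0
  have h2 : (b + 1) ^ (((2 : ℝ) * r + 1) / (2 * r - 1)) ≤ (b + 1) ^ (3 : ℝ) :=
    Real.rpow_le_rpow_of_exponent_le (by linarith) he3
  have h3 : (b + 1) ^ (3 : ℝ) = (b + 1) ^ (3 : ℕ) := by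
    rw [← Real.rpow_natCast]
    norm_num
  have h4 : b + 1 ≤ 2 ^ (r + 1) * (c' / ν + 1) := by
    have h21 : (1 : ℝ) ≤ 2 ^ (r + 1) := one_le_pow₀ (by norm_num)
    have : b = 2 ^ (r + 1) * (c' / ν) := by rw [hb]; ring
    rw [this]
    nlinarith [div_pos hc hν]
  have h5 : (b + 1) ^ (3 : ℕ) ≤ (2 ^ (r + 1) * (c' / ν + 1)) ^ (3 : ℕ) :=
    pow_le_pow_left₀ (by linarith) h4 3
  have h6 : (2 ^ (r + 1) * (c' / ν + 1)) ^ (3 : ℕ) = (8 : ℝ) ^ (r + 1) * (c' / ν + 1) ^ 3 := by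
    rw [mul_pow, ← pow_mul, mul_comm (r + 1) 3, pow_mul]
    norm_num
  calc b ^ (((2 : ℝ) * r + 1) / (2 * r - 1))
      ≤ (b + 1) ^ (((2 : ℝ) * r + 1) / (2 * r - 1)) := h1
    _ ≤ (b + 1) ^ (3 : ℝ) := h2
    _ = (b + 1) ^ (3 : ℕ) := h3
    _ ≤ (2 ^ (r + 1) * (c' / ν + 1)) ^ (3 : ℕ) := h5
    _ = 8 ^ (r + 1) * (c' / ν + 1) ^ 3 := h6

/-- `(K₃²)^{2r/(2r−1)} ≤ (K₃² + 1)²` for `r ≥ 1`. [cite: LiJunDe2013NSPeriodic, eq. (38)–(42) pp. 7–8] -/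
private theorem dataPow_le {r : ℕ} (hr : 1 ≤ r) (K : ℝ) (hK : 0 ≤ K) :
    K ^ expo r ≤ (K + 1) ^ 2 := by
  have h1 : K ^ expo r ≤ (K + 1) ^ expo r :=
    Real.rpow_le_rpow hK (by linarith) (expo_nonneg_of_one_le hr)
  have h2 : (K + 1) ^ expo r ≤ (K + 1) ^ (2 : ℝ) :=
    Real.rpow_le_rpow_of_exponent_le (by linarith) (expo_le_two_of_one_le hr)
  have h3 : (K + 1) ^ (2 : ℝ) = (K + 1) ^ (2 : ℕ) := by
    rw [← Real.rpow_natCast]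
    norm_num
  calc K ^ expo r ≤ (K + 1) ^ expo r := h1
    _ ≤ (K + 1) ^ (2 : ℝ) := h2
    _ = (K + 1) ^ (2 : ℕ) := h3

/-- **STEP 4 holds** (p. 8, the sentence after (43): «the T in (43) can increase without bound as r
increases because, from (4), λ₁ = 4π²»): for every `T` there is an `r ≥ 1` with
`T·2r·c(r)λ₁^{−(r−1)}(K₃²)^{2r/(2r−1)} < 2r − 1`. Real arithmetic: `(4π²)^{r−1}` beats `8^{r+1} ≥
c(r)`-growth. Discharge of the typist's «TRUE-looking» flag; no bearing on the row's verdict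
(vacuous @ `DataClass38`). [cite: LiJunDe2013NSPeriodic, p. 8 after (43)] -/
theorem step4_horizonGrows_holds : Step4_HorizonGrows := by
  intro c' ν hc hν K₃ T
  by_cases hT : T ≤ 0
  · -- any `r` works when `T ≤ 0`: the left side is `≤ 0 < 1 = 2·1 − 1`
    refine ⟨1, le_rfl, ?_⟩
    have hX : 0 ≤ 2 * ((1 : ℕ) : ℝ) * (cConst 1 c' ν * (lam1 ^ (1 - 1))⁻¹) *
        ((K₃ : ℝ) ^ 2) ^ expo 1 := by
      have h1 : 0 ≤ cConst 1 c' ν := by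
        unfold cConst
        exact Real.rpow_nonneg (by positivity) _
      have h2 : 0 ≤ (lam1 ^ (1 - 1))⁻¹ := by simp
      have h3 : 0 ≤ ((K₃ : ℝ) ^ 2) ^ expo 1 := Real.rpow_nonneg (by positivity) _
      positivity
    have hle : T * (2 * ((1 : ℕ) : ℝ) * (cConst 1 c' ν * (lam1 ^ (1 - 1))⁻¹) *
        ((K₃ : ℝ) ^ 2) ^ expo 1) ≤ 0 := by
      have := mul_nonneg (neg_nonneg.mpr hT) hX
      linarith
    have h1 : (2 : ℝ) * ((1 : ℕ) : ℝ) - 1 = 1 := by norm_num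
    linarith
  · rw [not_le] at hT
    -- constants
    set A : ℝ := (c' / ν + 1) ^ 3 with hA
    set Kc : ℝ := ((K₃ : ℝ) ^ 2 + 1) ^ 2 with hKc
    set B : ℝ := 128 * T * A * Kc with hB
    set q : ℝ := 8 / lam1 with hq
    have hA0 : 0 < A := by positivity
    have hKc0 : 0 < Kc := by positivity
    have hB0 : 0 < B := by positivity
    have hq0 : 0 ≤ q := by rw [hq]; exact div_nonneg (by norm_num) lam1_pos'.le
    have hq1 : q < 1 := by rw [hq, div_lt_one lam1_pos']; exact eight_lt_lam1
    obtain ⟨n, hn⟩ := exists_pow_lt_of_lt_one (one_div_pos.mpr hB0) hq1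
    refine ⟨n + 1, by omega, ?_⟩
    have hr : 1 ≤ n + 1 := by omega
    rw [Nat.add_sub_cancel]
    -- the three nonnegative factors and their bounds
    have hX0 : 0 ≤ cConst (n + 1) c' ν := by
      unfold cConst
      exact Real.rpow_nonneg (by positivity) _
    have hXle : cConst (n + 1) c' ν ≤ 8 ^ (n + 1 + 1) * A := cConst_le hr hc hν
    have hL0 : 0 ≤ (lam1 ^ n)⁻¹ := inv_nonneg.mpr (pow_nonneg lam1_pos'.le n)
    have hP0 : 0 ≤ ((K₃ : ℝ) ^ 2) ^ expo (n + 1) := Real.rpow_nonneg (by positivity) _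
    have hPle : ((K₃ : ℝ) ^ 2) ^ expo (n + 1) ≤ Kc := dataPow_le hr _ (by positivity)
    have hcast : ((n + 1 : ℕ) : ℝ) = n + 1 := by push_cast; ring
    rw [hcast]
    have hn0 : (0 : ℝ) < n + 1 := by positivity
    -- bound the left side by `B·(n+1)·qⁿ`
    have hle : T * (2 * ((n : ℝ) + 1) * (cConst (n + 1) c' ν * (lam1 ^ n)⁻¹) *
        ((K₃ : ℝ) ^ 2) ^ expo (n + 1)) ≤
        T * (2 * ((n : ℝ) + 1) * (8 ^ (n + 1 + 1) * A * (lam1 ^ n)⁻¹) * Kc) := by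
      gcongr
    have heq : T * (2 * ((n : ℝ) + 1) * (8 ^ (n + 1 + 1) * A * (lam1 ^ n)⁻¹) * Kc) =
        B * (n + 1) * q ^ n := by
      have hqn : q ^ n = 8 ^ n * (lam1 ^ n)⁻¹ := by rw [hq, div_pow, div_eq_mul_inv]
      rw [hqn, hB, pow_add, pow_add]
      ring
    -- `B qⁿ < 1`
    have hBq : B * q ^ n < 1 := by
      have := mul_lt_mul_of_pos_left hn hB0
      rwa [mul_one_div_cancel hB0.ne'] at this
    have hlt : B * (n + 1) * q ^ n < (n : ℝ) + 1 := by
      have := mul_lt_mul_of_pos_right hBq hn0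
      linarith [this]
    calc T * (2 * ((n : ℝ) + 1) * (cConst (n + 1) c' ν * (lam1 ^ n)⁻¹) *
          ((K₃ : ℝ) ^ 2) ^ expo (n + 1))
        ≤ T * (2 * ((n : ℝ) + 1) * (8 ^ (n + 1 + 1) * A * (lam1 ^ n)⁻¹) * Kc) := hle
      _ = B * (n + 1) * q ^ n := heq
      _ < (n : ℝ) + 1 := hlt
      _ ≤ 2 * ((n : ℝ) + 1) - 1 := by linarith [(Nat.cast_nonneg n : (0 : ℝ) ≤ n)]

/-! ## Discharged TRUE steps: Step 2 (Poincaré chain (9)/(40)) and Step 3 (comparison (41)–(43))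
(append-only; ns-claims D-0026 debt pass, typist-9 g4, second block)

Step 2 is the termwise comparison `λ_k = 4π²|k|² ≥ λ₁ = 4π²` on the non-zero modes of a zero-average
field (finiteness of `‖v‖_r` for smooth `v`: the tree's `Torus.IsSmooth.memSobolev_holds`). Step 3
AS TYPED assumes `y` continuous on the CLOSED interval `[0,T]`, so its `∃ M` conclusion already follows
from compactness; the honest quantitative content of (41)–(43) — the explicit majorant up to the
horizon `T < T*` — is recorded as `step3_comparison42_profile`, the instance `p = 1 + 2r/(2r−1)` of the
tree's sharp comparison lemma `Literature.Analysis.ODE.le_profile_of_deriv_le_rpow`. -/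

section StepsTwoThree

/-- `|k|² ≥ 1` off the zero mode of the integer lattice. [folklore] -/
private theorem one_le_freqNormSq' {k : Fin 3 → ℤ} (hk : k ≠ 0) :
    1 ≤ FunctionSpaces.Torus.freqNormSq k := by
  obtain ⟨i, hi⟩ : ∃ i, k i ≠ 0 := by
    by_contra h
    exact hk (funext fun i => by simpa using not_exists.1 h i)
  have h1 : (1 : ℝ) ≤ ((k i : ℝ)) ^ 2 := by
    have : (1 : ℤ) ≤ (k i) ^ 2 := by
      have h0 : 0 < (k i) ^ 2 := by positivity
      omega
    exact_mod_cast this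
  exact h1.trans (Finset.single_le_sum (f := fun j => ((k j : ℝ)) ^ 2) (fun j _ => sq_nonneg _)
    (Finset.mem_univ i))

/-- **Monotonicity of the homogeneous scale in the order** (the Poincaré chain (9) p. 3 termwise:
`|k|^{2s} ≤ |k|^{2t}` for `0 ≤ s ≤ t` since `|k| ≥ 1` off the zero mode).
[cite: LiJunDe2013NSPeriodic, eq. (9) p. 3] -/
private theorem eHomSobolevSeminorm_mono_order {s t : ℝ} (hst : s ≤ t)
    (f : UnitAddTorus (Fin 3) → EuclideanSpace ℂ (Fin 3)) :
    FunctionSpaces.Torus.eHomSobolevSeminorm s f ≤ FunctionSpaces.Torus.eHomSobolevSeminorm t f := by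
  unfold FunctionSpaces.Torus.eHomSobolevSeminorm
  refine ENNReal.rpow_le_rpow (ENNReal.tsum_le_tsum fun k => ?_) (by norm_num)
  refine mul_le_mul' ?_ le_rfl
  split_ifs with hk
  · exact le_rfl
  · exact ENNReal.ofReal_le_ofReal
      (Real.rpow_le_rpow_of_exponent_le (one_le_freqNormSq' hk) hst)

/-- `|f|_{Ḣ^s} ≤ ‖f‖_{H^s}` for `s ≥ 0` (termwise `|k|^{2s} ≤ (1 + |k|²)^s`). [folklore] -/
private theorem eHomSobolevSeminorm_le_eSobolevNorm' {s : ℝ} (hs : 0 ≤ s)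
    (f : UnitAddTorus (Fin 3) → EuclideanSpace ℂ (Fin 3)) :
    FunctionSpaces.Torus.eHomSobolevSeminorm s f ≤ FunctionSpaces.Torus.eSobolevNorm s f := by
  unfold FunctionSpaces.Torus.eHomSobolevSeminorm FunctionSpaces.Torus.eSobolevNorm
  refine ENNReal.rpow_le_rpow (ENNReal.tsum_le_tsum fun k => ?_) (by norm_num)
  refine mul_le_mul' ?_ le_rfl
  have hq := FunctionSpaces.Torus.freqNormSq_nonneg k
  have hw : FunctionSpaces.Torus.sobolevWeight s k ^ 2 = (1 + FunctionSpaces.Torus.freqNormSq k) ^ s := by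
    rw [FunctionSpaces.Torus.sobolevWeight, ← Real.rpow_natCast,
      ← Real.rpow_mul (by linarith)]
    congr 1
    push_cast
    ring
  split_ifs with hk
  · exact zero_le
  · rw [hw]
    exact ENNReal.ofReal_le_ofReal (Real.rpow_le_rpow hq (by linarith) hs)

/-- Smooth fields have finite `‖·‖_r` for every `r` (Grafakos 2014 Thm 3.3.9 via the tree's
`Torus.IsSmooth.memSobolev_holds`). [cite: LiJunDe2013NSPeriodic, eq. (4)–(7) p. 3] -/
private theorem eHomSobolevSeminorm_complexify_lt_top
    {v : UnitAddTorus (Fin 3) → EuclideanSpace ℝ (Fin 3)} (hv : FunctionSpaces.Torus.IsSmooth v)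
    {s : ℝ} (hs : 0 ≤ s) :
    FunctionSpaces.Torus.eHomSobolevSeminorm s (complexify ∘ v) < ∞ := by
  have hcv : FunctionSpaces.Torus.IsSmooth (complexify ∘ v) :=
    FunctionSpaces.Torus.IsSmooth.comp_clm complexify.toContinuousLinearMap hv
  have hmem : FunctionSpaces.Torus.MemSobolev s (complexify ∘ v) :=
    FunctionSpaces.Torus.IsSmooth.memSobolev_holds (f := complexify ∘ v) hcv s
  exact (eHomSobolevSeminorm_le_eSobolevNorm' hs _).trans_lt hmem.eSobolevNorm_lt_top

/-- `‖v‖_r² < ∞` for smooth `v`. [cite: LiJunDe2013NSPeriodic, eq. (4)–(7) p. 3] -/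
private theorem normSq_lt_top {v : UnitAddTorus (Fin 3) → EuclideanSpace ℝ (Fin 3)}
    (hv : FunctionSpaces.Torus.IsSmooth v) (r : ℕ) : normSq r v < ∞ := by
  unfold normSq
  exact ENNReal.mul_lt_top ENNReal.ofReal_lt_top
    (ENNReal.pow_lt_top (eHomSobolevSeminorm_complexify_lt_top hv (Nat.cast_nonneg r)))

/-- **STEP 2 holds** ((40) p. 8, «the last inequality is derived after using (9)»): for every smooth
zero-average divergence-free field `v` and `r ≥ 1`, `‖v‖_r² < ∞` and `λ₁^{r−1}‖v‖₁² ≤ ‖v‖_r²` —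
termwise `λ_k^r = λ₁^{r−1}·λ₁|k|^{2r}·… ≥ λ₁^{r−1}λ_k` because `|k| ≥ 1` on the non-zero modes (the zero
mode is absent from the homogeneous seminorm). Discharge of the typist's «classical» flag; #40
(vacuous @ `DataClass38`) untouched. [cite: LiJunDe2013NSPeriodic, eq. (9) p. 3; (40) p. 8] -/
theorem step2_poincare40_holds : Step2_Poincare40 := by
  intro v hv r hr
  have hsm : FunctionSpaces.Torus.IsSmooth v := hv.1
  refine ⟨normSq_lt_top hsm r, ?_⟩
  -- the two homogeneous seminorms, `A = |v|_{Ḣ¹} ≤ B = |v|_{Ḣ^r}`, `B < ∞`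
  set A := FunctionSpaces.Torus.eHomSobolevSeminorm ((1 : ℕ) : ℝ) (complexify ∘ v) with hA
  set B := FunctionSpaces.Torus.eHomSobolevSeminorm (r : ℝ) (complexify ∘ v) with hB
  have hAB : A ≤ B := eHomSobolevSeminorm_mono_order (by exact_mod_cast hr) _
  have hBtop : B < ∞ := eHomSobolevSeminorm_complexify_lt_top hsm (Nat.cast_nonneg r)
  have hB2top : B ^ 2 ≠ ∞ := (ENNReal.pow_lt_top hBtop).ne
  have hAB2 : (A ^ 2).toReal ≤ (B ^ 2).toReal :=
    ENNReal.toReal_mono hB2top (pow_le_pow_left' hAB 2)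
  have h1 : (normSq 1 v).toReal = (2 * Real.pi) ^ (2 * 1) * (A ^ 2).toReal := by
    unfold normSq
    rw [ENNReal.toReal_mul, ENNReal.toReal_ofReal (by positivity)]
  have h2 : (normSq r v).toReal = (2 * Real.pi) ^ (2 * r) * (B ^ 2).toReal := by
    unfold normSq
    rw [ENNReal.toReal_mul, ENNReal.toReal_ofReal (by positivity)]
  rw [h1, h2]
  -- constants: `λ₁^{r−1} (2π)² = (2π)^{2r}`
  have hconst : lam1 ^ (r - 1) * (2 * Real.pi) ^ (2 * 1) = (2 * Real.pi) ^ (2 * r) := by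
    have hr' : 2 * (r - 1) + 2 * 1 = 2 * r := by omega
    rw [lam1, show (4 : ℝ) * Real.pi ^ 2 = (2 * Real.pi) ^ 2 by ring, ← pow_mul, ← pow_add, hr']
  calc lam1 ^ (r - 1) * ((2 * Real.pi) ^ (2 * 1) * (A ^ 2).toReal)
      = (2 * Real.pi) ^ (2 * r) * (A ^ 2).toReal := by rw [← mul_assoc, hconst]
    _ ≤ (2 * Real.pi) ^ (2 * r) * (B ^ 2).toReal :=
        mul_le_mul_of_nonneg_left hAB2 (by positivity)

/-- **STEP 3 holds** ((41) ⇒ (42) ⇒ (43) p. 8). As typed, `y` is continuous on the closed interval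
`[0,T]`, so the `∃ M`-bound is compactness (`IsCompact.exists_isMaxOn`); the explicit majorant of the
printed comparison is `step3_comparison42_profile`. Discharge of the typist's «classical ODE
comparison» flag; #40 untouched. [cite: LiJunDe2013NSPeriodic, eq. (41)–(43) p. 8] -/
theorem step3_comparison42_holds : Step3_Comparison42 := by
  intro y T C y₀ r _hr _hC _hy₀ hcont _hnn _hy0 _hder _hT
  rcases (Icc (0 : ℝ) T).eq_empty_or_nonempty with h | h
  · exact ⟨0, fun t ht => by simp [h] at ht⟩
  · obtain ⟨t₀, _, hmax⟩ := isCompact_Icc.exists_isMaxOn h hcont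
    exact ⟨y t₀, fun t ht => (isMaxOn_iff.mp hmax) t ht⟩

/-- `2r/(2r−1) > 0` for `r ≥ 1`. [cite: LiJunDe2013NSPeriodic, eq. (39)–(42) p. 8] -/
private theorem expo_pos_of_one_le {r : ℕ} (hr : 1 ≤ r) : 0 < expo r := by
  unfold expo
  have hr' : (1 : ℝ) ≤ r := by exact_mod_cast hr
  exact div_pos (by linarith) (by linarith)

/-- **The quantitative content of Step 3** ((41)–(43) p. 8, «Applying the Gronwall type of
inequality»): under the hypotheses of `Step3_Comparison42`, with `e = 2r/(2r−1)`,
`y(t) ≤ y(0)·(1 − e·C·y(0)^e·t)^{−1/e}` on `[0,T]` — (42) with the horizon condition (43)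
`T·2rC·y₀^e < 2r − 1` guaranteeing `e·C·y(0)^e·T < 1`. Instance `p = 1 + e` of the tree's sharp
comparison lemma `Literature.Analysis.ODE.le_profile_of_deriv_le_rpow` (Robinson–Rodrigo–Sadowski 2016,
§6.2). [cite: LiJunDe2013NSPeriodic, eq. (41)–(43) p. 8] -/
theorem step3_comparison42_profile (y : ℝ → ℝ) (T C y₀ : ℝ) (r : ℕ) (hr : 1 ≤ r) (hC : 0 < C)
    (_hy₀ : 0 ≤ y₀) (hcont : ContinuousOn y (Icc 0 T)) (hnn : ∀ t ∈ Icc 0 T, 0 ≤ y t)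
    (hy0 : y 0 ≤ y₀)
    (hder : ∀ t ∈ Ico 0 T, ∃ y' : ℝ, HasDerivWithinAt y y' (Ici t) t ∧ y' ≤ C * y t * y t ^ expo r)
    (hT : T * (2 * r * C * y₀ ^ expo r) < 2 * r - 1) :
    ∀ t ∈ Icc 0 T, y t ≤ y 0 * (1 - expo r * C * y 0 ^ expo r * t) ^ (-(1 / expo r)) := by
  classical
  intro t ht
  have hT0 : 0 ≤ T := ht.1.trans ht.2
  have he : 0 < expo r := expo_pos_of_one_le hr
  have hr' : (1 : ℝ) ≤ r := by exact_mod_cast hr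
  -- a derivative FUNCTION chosen from the pointwise `∃`
  set y'f : ℝ → ℝ := fun s => if h : s ∈ Ico 0 T then Classical.choose (hder s h) else 0 with hy'f
  have hy' : ∀ s ∈ Ico 0 T, HasDerivWithinAt y (y'f s) (Ici s) s := by
    intro s hs
    simp only [hy'f, dif_pos hs]
    exact (Classical.choose_spec (hder s hs)).1
  have hineq : ∀ s ∈ Ico 0 T, y'f s ≤ C * y s ^ (1 + expo r) := by
    intro s hs
    simp only [hy'f, dif_pos hs]
    have h2 := (Classical.choose_spec (hder s hs)).2
    have hys : 0 ≤ y s := hnn s (Ico_subset_Icc_self hs)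
    rw [Real.rpow_add' hys (by linarith), Real.rpow_one, ← mul_assoc]
    exact h2
  -- the horizon condition (43) ⇒ `e·C·y(0)^e·T < 1`
  have hhor : (1 + expo r - 1) * C * y 0 ^ (1 + expo r - 1) * T < 1 := by
    rw [add_sub_cancel_left]
    have hy0e : y 0 ^ expo r ≤ y₀ ^ expo r :=
      Real.rpow_le_rpow (hnn 0 ⟨le_rfl, hT0⟩) hy0 he.le
    have hden : (0 : ℝ) < 2 * r - 1 := by linarith
    have h1 : expo r * C * y₀ ^ expo r * T < 1 := by
      have : expo r * C * y₀ ^ expo r * T = T * (2 * r * C * y₀ ^ expo r) / (2 * r - 1) := by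
        unfold expo
        field_simp
      rw [this, div_lt_one hden]
      exact hT
    have h2 : expo r * C * y 0 ^ expo r * T ≤ expo r * C * y₀ ^ expo r * T := by
      have : 0 ≤ expo r * C := by positivity
      nlinarith [mul_nonneg this (sub_nonneg.mpr hy0e), hT0]
    exact lt_of_le_of_lt h2 h1
  have h := Literature.Analysis.ODE.le_profile_of_deriv_le_rpow (p := 1 + expo r) (by linarith)
    hC.le hcont hy' hnn hineq hhor t ht
  simpa only [add_sub_cancel_left] using h

end StepsTwoThree

/-! ## §E. The Clay bridge is a theorem (D-0026 discharge; ns-claims-typist-9 g5, 2026-08-27)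

`ClayBridge` (§B) is the classical bookkeeping «torus datum of the paper's zero-average class ⇒ Clay (B)
solution on `ℝ³ × [0,∞)`», recorded in §B as «a classical bridge, not a claim of the paper». It is now
PROVED from the cell's reference files: the mean-zero descent `ClayVariants.exists_meanZero_descend`
(Lemarié-Rieusset 2016 §1.3: periodic fields on `ℝ³` = fields on `ℝ³/ℤ³`; the mean is a Galilean
velocity, Majda–Bertozzi 2002 §1.2), the horizon patching
`Torus.IsClassicalNSSolutionOn.exists_Ici_iff_forall_Icc` (Robinson–Rodrigo–Sadowski 2016 §8.1:
classical solutions on every `[0,T]` from one datum patch to `[0,∞)` by uniqueness), and the Galilean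
undo `ClayVariants.solvable_of_torus_global_sub_const`. Nothing here bears on the verdict of record for
C24 (#37: `Step5_Proposal5`/`AbstractClaim` side, see the CARD); `AbstractClaim` and `Step1_Lemma4`
stay OPEN. -/

/-- **`ClayBridge` holds**: for every `ν > 0` and every Clay (B) datum `u₀` (smooth, divergence free,
`ℤ³`-periodic on `ℝ³`) the mean-zero descent `w₀` of `u₀ − ∫u₀` is a datum of the paper's class
(`IsDatum`: smooth, divergence free, zero average on the unit torus), and solvability from `w₀` on every
`[0,T]` in the sense `IsSmoothSolution` gives a Clay-sense periodic solution from `u₀`: patch the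
horizons to a global torus solution, lift to `ℝ³`, undo the Galilean normalisation of the mean.
[cite: FeffermanClay2006, (B) with (8) (10) (11), p. 2] [cite: LemarieRieusset2016, §1.3 eqs. (1.10)–(1.13)]
[cite: MajdaBertozziCUP2002, §1.2] [cite: RobinsonRodrigoSadowskiCUP2016, §8.1] -/
theorem clayBridge_holds : ClayBridge := by
  intro ν hν u₀ hsmooth hdiv hper
  obtain ⟨m, w₀, hw₀s, hw₀d, hw₀m, hlift⟩ := ClayVariants.exists_meanZero_descend hsmooth hdiv hper
  refine ⟨w₀, ⟨hw₀s, hw₀d, hw₀m⟩, fun H => ?_⟩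
  -- every-horizon solutions on `[0,T]` from `w₀` patch to a global torus solution
  have hIcc : ∀ T : ℝ, 0 < T →
      ∃ (U : ℝ → UnitAddTorus (Fin 3) → EuclideanSpace ℝ (Fin 3)) (P : ℝ → UnitAddTorus (Fin 3) → ℝ),
        FunctionSpaces.Torus.IsClassicalNSSolutionOn (Icc 0 T) ν 0 U P ∧ U 0 = w₀ := by
    intro T hT
    obtain ⟨u, p, hsol, h0, -, -⟩ := H T hT
    exact ⟨u, p, hsol, h0⟩
  obtain ⟨W, P, hW, hW0⟩ :=
    (FunctionSpaces.Torus.IsClassicalNSSolutionOn.exists_Ici_iff_forall_Icc hν.le).2 hIcc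
  -- lift and undo the Galilean normalisation of the mean
  exact (ClayVariants.solvable_of_torus_global_sub_const m hW (fun y => by rw [hW0]; exact hlift y)).1

/-- Hence the abstract's sentence ALONE implies Clay (B) (`clay_of_abstract` with the bridge discharged);
`AbstractClaim` itself stays OPEN (it is (B)-strength). [cite: FeffermanClay2006, (B) p. 2] -/
theorem clay_of_abstract' (hA : AbstractClaim) : ClayVariants.clayPeriodic.Regularity :=
  clay_of_abstract clayBridge_holds hA

end

end Literature.Claims.NS.Li2013b
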